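/-
Origin: expansion seat `planner-pub-hodgecm-pv06-g3-0`, handover #1 2026-08-18T06:08:46Z (`HOME/pub-hodgecm-pv06-g3/lean/Pv06g3/CompactApprox.lean`, md5 4facd565, 305 lines);
landed by the gen-6 packager in gate run 24 as `HodgeCM/PerL34/CompactApprox.lean` (verbatim).
-/
/-
Origin: HOME/pub-hodgecm-pv06-g3/lean/Pv06g3/CompactApprox.lean — session planner-pub-hodgecm-pv06-g3-0 (unit
pub-hodgecm-pv06-g3, DAG-NODE PROVER #06 of 15, generation 3).  Intended final place: `HodgeCM/PerL34/CompactApprox.lean`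
(namespace `HodgeCM.PerL34.CompactApprox`).  Imports LANDED modules only (no WIP import, no rewrite needed).
Closed: nothing cited, nothing posited.

# The compact approximation of `L²(G ⧸ Γ)`, `G ⧸ Γ` compact — the Gelfand–Graev–Piatetski-Shapiro input, PROVED

The core carrier of the realisation (`HodgeCM.RepCoreCarrier`, seat prl1-g3, `HodgeCM/Automorphic/DiscreteDecomposition.lean`)
derives the DISCRETE DECOMPOSITION of `H = L²([U(W)])` from ONE remaining `L²`-side input,
`RepCoreCarrier.AnalyticK.compactApprox : RepDecomp.HasCompactApprox C.R` — a set `𝒦` of COMPACT, SYMMETRIC bounded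
operators, each mapping every closed `R`-invariant subspace into itself, which jointly move every non-zero vector —
whose published source is J. R. Getz, H. Hahn, *An Introduction to Automorphic Representations*, GTM 300 (2024),
Theorem 9.1.1 (Gelfand and Piatetski-Shapiro: `R(f)` is compact on the cuspidal spectrum; for anisotropic `U(W)` the
quotient `[U(W)]` is compact and the cuspidal spectrum is everything) with Lemma 9.3.1 / §9.3 (Dirac sequences).

This file PROVES that input in the honest model of `L²([U(W)])`: `H = Lp ℂ 2 ν` for `X = G ⧸ Γ` a COMPACT quotient of a
locally compact group `G` by a discrete, countable, closed subgroup `Γ`, `ν = map π (μ|𝓕)` the quotient of a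
bi-invariant measure `μ` on `G` through a fundamental domain `𝓕`, and `R = QuotientSmoothing.ρHom ν` the regular
representation `(ρ(g) v)(x) = v(g⁻¹ • x)`.  The witnesses are `𝒦 = {R(f)† ∘ R(f) | f ∈ C_c(G, ℝ)}` with
`R(f) = ∫ f(g) ρ(g) dμ(g)` the smoothing operators of `ApproxIdentity` (= `QuotientSmoothing.smOpX`):

* §1 (abstract, any bounded strongly continuous representation `R` on a Hilbert space, `μ` finite on compacts):
  `orthogonal_invariant` (`Mᗮ` is invariant when `M` is and `R` preserves inner products), `adjoint_smOp_mem`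
  (`R(f)†` preserves closed invariant subspaces), `norm_smOp_sub_le` / `exists_norm_smOp_sub_lt` /
  `exists_smOp_ne_zero` (a single normalised bump `f` supported where `‖R(g)v - v‖ < ε/2` gives `‖R(f)v - v‖ < ε`;
  NO first-countability of `G` is needed, unlike a Dirac SEQUENCE), and
  `compactApproximation_of_isCompactOperator_smOp` : if every `R(f)` is a compact operator then
  `CompactApproximation R` — the statement `RepDecomp.HasCompactApprox R` with `RepDecomp.Invariant R M` unfolded to
  `∀ g, ∀ v ∈ M, R g v ∈ M` (verbatim otherwise; the by-name bridge is the separate file `CompactApproxBridge.lean`,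
  which imports prl1-g3's module); `CompactApproximation.of_comp` (transfer along a group homomorphism `ψ`:
  a compact approximation of `R ∘ ψ` is one of `R`).
* §2 (the model): `isUnitaryRep_ρHom`; **`isCompactOperator_smOpX`** — `R(f)` IS A COMPACT OPERATOR on `L²(G ⧸ Γ)`,
  from `QuotientSmoothing.smOpX_eq_opT` (`R(f) = 𝒯_{K_f}`, the continuous kernel `K_f(πa, πb) = ∑_γ f(a γ b⁻¹)`, PerL v5
  tex ll. 378–382) and `CharSeparation.isCompactOperator_opT` (a continuous kernel on a compact space gives a compact
  operator: Arzelà–Ascoli) — this is Getz–Hahn Thm 9.1.1 in the cocompact case, now a theorem of the package;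
  `isCompactOperator_integral_ρ` (the same on the bare function `v ↦ ∫ f(g) • ρ(g) v dμ`, the shape of the hypothesis
  `hK` of prl1-g3's `RepDecomp.hasCompactApprox_of_dirac'`); `t2Space_of_isClosed` (`G` is T₂ since `Γ` is discrete
  and closed); **`compactApproximation_ρHom`** — the compact approximation of the regular representation; and
  `compactApproximation_haar` — the same with every instance hypothesis on `ν` DERIVED from a regular Haar measure on
  the unimodular `G` (`QuotientSmoothingHaar`), so that the hypotheses are only the data of the model.

Nothing is left unproved and nothing is posited; `#print axioms` of every theorem is {propext, Classical.choice, Quot.sound}.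
-/
import Summits.HodgeConjecture.HodgeCM.PerL34.QuotientSmoothingHaar
import Summits.HodgeConjecture.HodgeCM.PerL34.CharSeparation_2
import Summits.HodgeConjecture.HodgeCM.PerL34.Spectral

set_option autoImplicit false

noncomputable section

open MeasureTheory Filter Topology Set
open scoped InnerProductSpace

namespace HodgeCM
namespace PerL34
namespace CompactApprox

/-! ## §1  Abstract part: bounded strongly continuous representations -/
section Abstract

variable {G : Type*} [Group G] [TopologicalSpace G] [MeasurableSpace G] [OpensMeasurableSpace G]
variable (μ : Measure G) [IsFiniteMeasureOnCompacts μ]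
variable {H : Type*} [NormedAddCommGroup H] [InnerProductSpace ℂ H] [CompleteSpace H]

/-- **A compact approximation of `R`**: VERBATIM `HodgeCM.RepDecomp.HasCompactApprox R` (seat prl1-g3,
`HodgeCM/Automorphic/DiscreteDecomposition.lean`) with `RepDecomp.Invariant R M` unfolded to its definition
`∀ g, ∀ v ∈ M, R g v ∈ M`: a set `𝒦` of bounded operators, each COMPACT, SYMMETRIC and mapping every closed
`R`-invariant subspace into itself, such that every non-zero vector is moved by some `K ∈ 𝒦`. -/
def CompactApproximation (R : G →* (H →L[ℂ] H)) : Prop :=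
  ∃ 𝒦 : Set (H →L[ℂ] H),
    (∀ K ∈ 𝒦, IsCompactOperator K ∧ (K : H →ₗ[ℂ] H).IsSymmetric ∧
      ∀ M : Submodule ℂ H, IsClosed (M : Set H) → (∀ (g : G), ∀ v ∈ M, R g v ∈ M) → ∀ v ∈ M, K v ∈ M) ∧
    ∀ v : H, v ≠ 0 → ∃ K ∈ 𝒦, K v ≠ 0

omit [TopologicalSpace G] [MeasurableSpace G] [OpensMeasurableSpace G] [CompleteSpace H] in
/-- **Transfer along a homomorphism of groups.**  A compact approximation of `R ∘ ψ` is one of `R` (an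
`R`-invariant subspace is `R ∘ ψ`-invariant).  Used to pass between the `G`-indexed regular representation
`QuotientSmoothing.ρHom` and its `Gᵈᵐᵃ`-indexed form (`RepDecomp.koopman`, seat prl1-g3). -/
theorem CompactApproximation.of_comp {G' : Type*} [Group G'] (R : G →* (H →L[ℂ] H)) (ψ : G' →* G)
    (h : CompactApproximation (R.comp ψ)) : CompactApproximation R := by
  obtain ⟨𝒦, h𝒦, hne⟩ := h
  refine ⟨𝒦, fun K hK => ?_, hne⟩
  obtain ⟨hc, hs, hm⟩ := h𝒦 K hK
  exact ⟨hc, hs, fun M hMc hM v hv => hm M hMc (fun g' w hw => hM (ψ g') w hw) v hv⟩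

omit [TopologicalSpace G] [MeasurableSpace G] [OpensMeasurableSpace G] [CompleteSpace H] in
/-- For an inner-product preserving representation, `Mᗮ` is invariant when `M` is. -/
theorem orthogonal_invariant {R : G →* (H →L[ℂ] H)} (hU : Spectral.IsUnitaryRep R) {M : Submodule ℂ H}
    (hM : ∀ (g : G), ∀ v ∈ M, R g v ∈ M) (g : G) {w : H} (hw : w ∈ Mᗮ) : R g w ∈ Mᗮ := by
  rw [Submodule.mem_orthogonal]
  intro u hu
  have hback : R g⁻¹ (R g w) = w := by
    change (R g⁻¹ * R g) w = w
    rw [← map_mul, inv_mul_cancel, map_one]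
    rfl
  rw [← hU g⁻¹ u (R g w), hback]
  exact (Submodule.mem_orthogonal M w).mp hw _ (hM g⁻¹ u hu)

variable (R : G →* (H →L[ℂ] H)) (hRc : ∀ v : H, Continuous fun g => R g v) (c : ℝ) (hRb : ∀ g, ‖R g‖ ≤ c)

/-- **The adjoint `R(f)†` preserves every closed invariant subspace** (because `R(f)` preserves `Mᗮ`). -/
theorem adjoint_smOp_mem (hU : Spectral.IsUnitaryRep R) (f : G → ℝ) (hf : Continuous f)
    (hfs : HasCompactSupport f) {M : Submodule ℂ H} (hMc : IsClosed (M : Set H))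
    (hM : ∀ (g : G), ∀ v ∈ M, R g v ∈ M) {v : H} (hv : v ∈ M) :
    ContinuousLinearMap.adjoint (ApproxIdentity.smOp μ R hRc c hRb f hf hfs) v ∈ M := by
  haveI : CompleteSpace M := hMc.isComplete.completeSpace_coe
  rw [← Submodule.orthogonal_orthogonal M, Submodule.mem_orthogonal]
  intro w hw
  rw [ContinuousLinearMap.adjoint_inner_right]
  have hTw : ApproxIdentity.smOp μ R hRc c hRb f hf hfs w ∈ Mᗮ :=
    ApproxIdentity.smOp_mem_of_invariant μ R hRc c hRb f hf hfs Mᗮ (Submodule.isClosed_orthogonal M)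
      (fun g u hu => orthogonal_invariant hU hM g hu) hw
  exact Submodule.inner_left_of_mem_orthogonal hv hTw

/-- `‖R(f) v - v‖ ≤ δ` for a non-negative test function `f` of integral one supported where `‖R(g) v - v‖ ≤ δ`. -/
theorem norm_smOp_sub_le (f : G → ℝ) (hf : Continuous f) (hfs : HasCompactSupport f)
    (hf0 : ∀ g, 0 ≤ f g) (hf1 : ∫ g, f g ∂μ = 1) (v : H) {δ : ℝ}
    (hδ : ∀ g ∈ Function.support f, ‖R g v - v‖ ≤ δ) :
    ‖ApproxIdentity.smOp μ R hRc c hRb f hf hfs v - v‖ ≤ δ := by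
  have hint := ApproxIdentity.integrable_smul_apply μ R hRc f hf hfs v
  have hintc : Integrable (fun g => (f g : ℂ) • v) μ := by
    refine ((Complex.continuous_ofReal.comp hf).smul continuous_const).integrable_of_hasCompactSupport ?_
    exact HasCompactSupport.intro' hfs.isCompact (isClosed_tsupport _) fun x hx => by
      simp [image_eq_zero_of_notMem_tsupport hx]
  have hone : ∫ g, (f g : ℂ) ∂μ = 1 := by
    rw [integral_complex_ofReal, hf1, Complex.ofReal_one]
  have hdiff : ApproxIdentity.smOp μ R hRc c hRb f hf hfs v - v = ∫ g, (f g : ℂ) • (R g v - v) ∂μ := by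
    simp only [smul_sub]
    rw [integral_sub hint hintc, integral_smul_const, hone, one_smul, ApproxIdentity.smOp_apply]
  have hpt : ∀ g, ‖(f g : ℂ) • (R g v - v)‖ ≤ f g * δ := by
    intro g
    rw [norm_smul, Complex.norm_real, Real.norm_eq_abs, abs_of_nonneg (hf0 g)]
    by_cases hg : f g = 0
    · simp [hg]
    · exact mul_le_mul_of_nonneg_left (hδ g (Function.mem_support.mpr hg)) (hf0 g)
  calc ‖ApproxIdentity.smOp μ R hRc c hRb f hf hfs v - v‖
      = ‖∫ g, (f g : ℂ) • (R g v - v) ∂μ‖ := by rw [hdiff]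
    _ ≤ ∫ g, f g * δ ∂μ :=
        norm_integral_le_of_norm_le ((hf.integrable_of_hasCompactSupport hfs).mul_const _) (ae_of_all _ hpt)
    _ = δ := by rw [integral_mul_const, hf1, one_mul]

variable [LocallyCompactSpace G] [T2Space G] [μ.IsOpenPosMeasure]

/-- **`R(f) v` approximates `v`**: for every `v` and `ε > 0` some test function `f ∈ C_c(G, ℝ)` has
`‖R(f) v - v‖ < ε` (one normalised Urysohn bump inside `{g | ‖R(g) v - v‖ < ε / 2}`; no countability hypothesis). -/
theorem exists_norm_smOp_sub_lt (v : H) {ε : ℝ} (hε : 0 < ε) :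
    ∃ (f : G → ℝ) (hf : Continuous f) (hfs : HasCompactSupport f),
      ‖ApproxIdentity.smOp μ R hRc c hRb f hf hfs v - v‖ < ε := by
  set U : Set G := {g | ‖R g v - v‖ < ε / 2} with hU
  have hUo : IsOpen U := isOpen_lt ((hRc v).sub continuous_const).norm continuous_const
  have h1U : (1 : G) ∈ U := by
    change ‖R 1 v - v‖ < ε / 2
    rw [map_one]
    change ‖v - v‖ < ε / 2
    rw [sub_self, norm_zero]
    exact half_pos hε
  obtain ⟨φ, hφc, hφs, hφ0, hφ1, hφU⟩ := Vanishing.exists_bump_subset (1 : G) hUo h1U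
  have hpos : 0 < ∫ g, φ g ∂μ :=
    hφc.integral_pos_of_hasCompactSupport_nonneg_nonzero hφs (fun x => hφ0 x) (by rw [hφ1]; exact one_ne_zero)
  have hfs : HasCompactSupport fun g => φ g / ∫ x, φ x ∂μ :=
    HasCompactSupport.intro' hφs.isCompact (isClosed_tsupport _) fun x hx => by
      simp [image_eq_zero_of_notMem_tsupport hx]
  refine ⟨fun g => φ g / ∫ x, φ x ∂μ, hφc.div_const _, hfs, lt_of_le_of_lt ?_ (half_lt_self hε)⟩
  refine norm_smOp_sub_le μ R hRc c hRb _ (hφc.div_const _) hfs (fun g => div_nonneg (hφ0 g) hpos.le)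
    (by rw [integral_div, div_self hpos.ne']) v fun g hg => ?_
  have hg' : φ g ≠ 0 := by
    intro h0
    exact hg (by simp [h0])
  exact le_of_lt (hφU (Function.mem_support.mpr hg'))

/-- Hence **every non-zero vector is moved by some `R(f)`**. -/
theorem exists_smOp_ne_zero {v : H} (hv : v ≠ 0) :
    ∃ (f : G → ℝ) (hf : Continuous f) (hfs : HasCompactSupport f),
      ApproxIdentity.smOp μ R hRc c hRb f hf hfs v ≠ 0 := by
  obtain ⟨f, hf, hfs, hlt⟩ := exists_norm_smOp_sub_lt μ R hRc c hRb v (norm_pos_iff.mpr hv)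
  refine ⟨f, hf, hfs, fun h0 => ?_⟩
  rw [h0, zero_sub, norm_neg] at hlt
  exact lt_irrefl _ hlt

/-- **The compact approximation from compactness of the `R(f)`.**  For an inner-product preserving, strongly
continuous, bounded representation `R` all of whose smoothing operators `R(f)`, `f ∈ C_c(G, ℝ)`, are compact, the
operators `R(f)† ∘ R(f)` are compact, symmetric, preserve every closed invariant subspace, and move every non-zero
vector. -/
theorem compactApproximation_of_isCompactOperator_smOp (hU : Spectral.IsUnitaryRep R)
    (hK : ∀ (f : G → ℝ) (hf : Continuous f) (hfs : HasCompactSupport f),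
      IsCompactOperator (ApproxIdentity.smOp μ R hRc c hRb f hf hfs)) :
    CompactApproximation R := by
  refine ⟨{K | ∃ (f : G → ℝ) (hf : Continuous f) (hfs : HasCompactSupport f),
      K = (ContinuousLinearMap.adjoint (ApproxIdentity.smOp μ R hRc c hRb f hf hfs)).comp
        (ApproxIdentity.smOp μ R hRc c hRb f hf hfs)}, ?_, ?_⟩
  · rintro K ⟨f, hf, hfs, rfl⟩
    have hcpt : IsCompactOperator ((ContinuousLinearMap.adjoint (ApproxIdentity.smOp μ R hRc c hRb f hf hfs)).comp
        (ApproxIdentity.smOp μ R hRc c hRb f hf hfs)) := by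
      have h := (hK f hf hfs).clm_comp (ContinuousLinearMap.adjoint (ApproxIdentity.smOp μ R hRc c hRb f hf hfs))
      rwa [← ContinuousLinearMap.coe_comp] at h
    refine ⟨hcpt, fun u w => ?_, fun M hMc hM v hv => ?_⟩
    · simp only [ContinuousLinearMap.coe_coe, ContinuousLinearMap.comp_apply,
        ContinuousLinearMap.adjoint_inner_left, ContinuousLinearMap.adjoint_inner_right]
    · rw [ContinuousLinearMap.comp_apply]
      exact adjoint_smOp_mem μ R hRc c hRb hU f hf hfs hMc hM
        (ApproxIdentity.smOp_mem_of_invariant μ R hRc c hRb f hf hfs M hMc hM hv)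
  · intro v hv
    obtain ⟨f, hf, hfs, hne⟩ := exists_smOp_ne_zero μ R hRc c hRb hv
    refine ⟨_, ⟨f, hf, hfs, rfl⟩, fun h0 => hne ?_⟩
    have h1 := congrArg (fun w => ⟪w, v⟫_ℂ) h0
    simpa only [ContinuousLinearMap.comp_apply, ContinuousLinearMap.adjoint_inner_left, inner_zero_left,
      inner_self_eq_zero] using h1

end Abstract

/-! ## §2  The model: the regular representation on `L²(G ⧸ Γ)`, `G ⧸ Γ` compact -/
section Model

open QuotientSmoothing

/-- A topological group with a discrete CLOSED subgroup is T₂ (`{1}` is closed in the discrete `Γ`, which is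
closed in `G`). -/
theorem t2Space_of_isClosed {G : Type*} [Group G] [TopologicalSpace G] [IsTopologicalGroup G]
    {Γ : Subgroup G} [DiscreteTopology Γ] (hΓ : IsClosed (Γ : Set G)) : T2Space G := by
  have h1 : IsClosed ({1} : Set G) := by
    have h := hΓ.isClosedEmbedding_subtypeVal.isClosedMap _ (isClosed_discrete ({1} : Set Γ))
    simpa using h
  exact IsTopologicalGroup.t2Space_iff_one_closed.mpr h1

variable {G : Type*} [Group G] [TopologicalSpace G] [IsTopologicalGroup G] {Γ : Subgroup G}
variable [MeasurableSpace (G ⧸ Γ)] [BorelSpace (G ⧸ Γ)] (ν : Measure (G ⧸ Γ)) [SMulInvariantMeasure G (G ⧸ Γ) ν]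

/-- **The regular representation preserves inner products** (`Lp.compMeasurePreservingₗᵢ` is a linear isometry). -/
theorem isUnitaryRep_ρHom : Spectral.IsUnitaryRep (ρHom ν) := fun g u v =>
  (Lp.compMeasurePreservingₗᵢ ℂ (act g : G ⧸ Γ → G ⧸ Γ) (measurePreserving_act ν g)).inner_map_map u v

variable [T2Space (G ⧸ Γ)] [IsFiniteMeasure ν] [ν.InnerRegularCompactLTTop] [CompactSpace (G ⧸ Γ)]
variable [MeasurableSpace G] [BorelSpace G] (μ : Measure G) [IsFiniteMeasureOnCompacts μ]
variable [LocallyCompactSpace G] [DiscreteTopology Γ] [Countable Γ] (hΓ : IsClosed (Γ : Set G))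
  [μ.IsMulLeftInvariant] [μ.IsMulRightInvariant] [μ.IsInvInvariant]
  {𝓕 : Set G} (h𝓕 : IsFundamentalDomain Γ.op 𝓕 μ)
  (hν : ν = Measure.map (QuotientGroup.mk : G → G ⧸ Γ) (μ.restrict 𝓕))

include hΓ h𝓕 hν in
/-- **`R(f)` is a compact operator on `L²(G ⧸ Γ)`** (Getz–Hahn Thm 9.1.1 = Gelfand–Graev–Piatetski-Shapiro in the
cocompact case — PROVED): `R(f) = 𝒯_{K_f}` (`QuotientSmoothing.smOpX_eq_opT`) is the operator of a continuous kernel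
on the compact `X × X`, hence compact (`CharSeparation.isCompactOperator_opT`). -/
theorem isCompactOperator_smOpX (f : G → ℝ) (hf : Continuous f) (hfs : HasCompactSupport f) :
    IsCompactOperator (smOpX ν μ f hf hfs) := by
  rw [smOpX_eq_opT ν μ f hf hfs hΓ h𝓕 hν]
  exact CharSeparation.isCompactOperator_opT _ ν ν

include hΓ h𝓕 hν in
/-- The same on the bare function `v ↦ ∫ f(g) • ρ(g) v dμ` (the shape of the compactness hypothesis `hK` of
`RepDecomp.hasCompactApprox_of_dirac'`, with `R = ρHom ν`). -/
theorem isCompactOperator_integral_ρ (f : G → ℝ) (hf : Continuous f) (hfs : HasCompactSupport f) :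
    IsCompactOperator fun v : Lp ℂ 2 ν => ∫ g, (f g : ℂ) • ρHom ν g v ∂μ :=
  isCompactOperator_smOpX ν μ hΓ h𝓕 hν f hf hfs

include hΓ h𝓕 hν in
/-- **THE COMPACT APPROXIMATION OF THE REGULAR REPRESENTATION ON `L²(G ⧸ Γ)`, `G ⧸ Γ` COMPACT — PROVED.**
`𝒦 = {R(f)† ∘ R(f) | f ∈ C_c(G, ℝ)}`: compact (`isCompactOperator_smOpX`), symmetric, preserving every closed
invariant subspace (`ApproxIdentity.smOp_mem_of_invariant`, `adjoint_smOp_mem`), jointly moving every non-zero vector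
(`exists_smOp_ne_zero`).  This is `RepDecomp.HasCompactApprox (ρHom ν)` with `Invariant` unfolded. -/
theorem compactApproximation_ρHom [μ.IsOpenPosMeasure] : CompactApproximation (ρHom ν) := by
  haveI : T2Space G := t2Space_of_isClosed hΓ
  exact compactApproximation_of_isCompactOperator_smOp μ (ρHom ν) (continuous_ρ_apply ν) 1 (opNorm_ρ_le_one ν)
    (isUnitaryRep_ρHom ν) (isCompactOperator_smOpX ν μ hΓ h𝓕 hν)

end Model

/-! ## §3  The model on Haar measure: the instance hypotheses discharged -/
section Haar

open QuotientSmoothing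

attribute [-instance] Quotient.instMeasurableSpace

variable {G : Type*} [Group G] [TopologicalSpace G] [IsTopologicalGroup G] [LocallyCompactSpace G]
  [MeasurableSpace G] [BorelSpace G] {Γ : Subgroup G} [DiscreteTopology Γ] [Countable Γ]
  (hΓ : IsClosed (Γ : Set G))
  [MeasurableSpace (G ⧸ Γ)] [BorelSpace (G ⧸ Γ)] [CompactSpace (G ⧸ Γ)]
  (μ : Measure G) [Measure.IsHaarMeasure μ] [μ.Regular] [μ.IsMulRightInvariant]
  {𝓕 : Set G} (h𝓕 : IsFundamentalDomain Γ.op 𝓕 μ)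

include hΓ h𝓕 in
/-- **The compact approximation of `L²(G ⧸ Γ)` for Haar measure.**  With `X = G ⧸ Γ` compact, `Γ` discrete, countable
and closed, `μ` a regular Haar measure on the unimodular `G` and `𝓕` a fundamental domain: the regular representation
on `L²(X, map π (μ|𝓕))` has a compact approximation.  Every instance hypothesis of `compactApproximation_ρHom` on `ν`
and `μ` is discharged (`QuotientSmoothingHaar`); the hypotheses are the data of the model only. -/
theorem compactApproximation_haar :
    haveI := hΓ
    haveI := smulInvariantMeasure_map_restrict μ h𝓕
    CompactApproximation (ρHom (Measure.map (QuotientGroup.mk : G → G ⧸ Γ) (μ.restrict 𝓕))) := by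
  haveI := hΓ
  haveI := smulInvariantMeasure_map_restrict μ h𝓕
  haveI := isFiniteMeasure_map_restrict (Γ := Γ) μ (measure_fundamentalDomain_lt_top μ h𝓕).ne
  haveI := innerRegularCompactLTTop_map_restrict (Γ := Γ) μ 𝓕
  haveI := isInvInvariant_of_isMulRightInvariant μ
  exact compactApproximation_ρHom _ μ hΓ h𝓕 rfl

end Haar

end CompactApprox
end PerL34
end HodgeCM

end
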